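import Literature.Probability.Percolation.NearCriticalOneArmFromThreeFacts
import Literature.Probability.Percolation.HalfPlaneTwoArmRadiiNearCritical
import HarnessLib

/-!
# Nolin's Thm. 27 (`j = 1`) from two named facts (proofs only)

Topic `Literature/Probability/Percolation`; family `crit-perc`. PROOFS ONLY (no definition, no named
fact). The half-plane two-arm estimates at two radii below the correlation length are now theorems
of the tree: `Werner2009_halfPlane_twoArm_holds` (`HalfPlaneTwoArmRadiiNearCritical.lean`) and
`Nolin2008_halfPlane_twoArm_holds` (`HalfPlaneTwoArmRadii.lean`), both by Kesten's inner separation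
of half-plane arms with RSW inputs uniform below `L(t, ε)`. This file removes the former from the leaf
set of `Nolin2008_thm27_oneArm_of_facts3` (`NearCriticalOneArmFromThreeFacts.lean`):

* `Nolin2008_thm27_oneArm_of_facts2` — Nolin 2008, Thm. 27 for one arm (`j = 1`) from the TWO
  named facts `Werner2009_fourArm_quasiMult` (Werner 2009, Lecture 6, Cor. 6.2: quasi-multiplicativity
  of four arms below `L(p)`) and `Werner2009_pivotal_lowerBound` (proof of Lemma 6.2: interior
  sites are pivotal with probability `≥ c π̂`), both consequences of Kesten's separation of four
  arms below `L(p)` (Nolin 2008, Thm. 11, Props. 12–13, 17).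

The companion statement for Werner's form of the one-arm stability,
`Werner2009_oneArm_nearCritical_of_facts2`, is `WernerOneArmStabilityFromTwoFacts.lean`; its module
docstring also records why the two remaining facts, stated with the order-free four-arm event
`armEvent ![T,F,T,F]`, involve both cyclic colour patterns (see `AltFourArm.lean` for the
alternating event).

The other direction of each comparison (the lower bound at `p > 1/2`, the upper bound at
`p < 1/2`) is monotonicity in `p` and holds unconditionally (`critOneArmProb_le_real_triOneArm`,
`NearCriticalScalingOneArmProofs.lean`); what the two facts buy is the differential inequality
`|d/dt log P_t(0 ↔ ∂Λ_N)| ≤ C N² π̂_t(N)` summed below `L(t)`.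

## References

* P. Nolin, Near-critical percolation in two dimensions, *Electron. J. Probab.* 13 (2008)
  1562–1623, §6.1–6.2, Thm. 27 and its proof, case `j = 1` (arXiv 0711.4948: Thm. 26) [Nolin2008].
* W. Werner, *Lectures on two-dimensional critical percolation*, IAS/Park City Math. Ser. 16
  (2009), Lecture 6, §3–§5, Prop. 6.1, Cor. 6.1–6.2, Lemma 6.2 [WernerPCMI2009].
* H. Kesten, Scaling relations for 2D-percolation, *Comm. Math. Phys.* 109 (1987), 109–156
  [KestenScalingCMP1987].

Tree: `Nolin2008_thm27_oneArm_of_facts3` (`NearCriticalOneArmFromThreeFacts.lean`),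
`Werner2009_halfPlane_twoArm_holds` (`HalfPlaneTwoArmRadiiNearCritical.lean`). Mathlib: nothing beyond
the imports of these files.
-/

namespace Literature.Probability.Percolation

/-- **Nolin's Thm. 27 for one arm from two named facts** (Nolin 2008, §6.1, Thm. 27
[arXiv 0711.4948: Thm. 26], `j = 1`): `Werner2009_fourArm_quasiMult` (Werner 2009, Cor. 6.2) and
`Werner2009_pivotal_lowerBound` (proof of Lemma 6.2); the half-plane leaf of
`Nolin2008_thm27_oneArm_of_facts3` is the theorem `Werner2009_halfPlane_twoArm_holds`. [cite: Nolin2008, §6.1–6.2, Thm. 27 and its proof (arXiv 0711.4948: Thm. 26), case j = 1] [cite: WernerPCMI2009, Lecture 6, §3–§5] -/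
theorem Nolin2008_thm27_oneArm_of_facts2 (hQM : Werner2009_fourArm_quasiMult)
    (hP : Werner2009_pivotal_lowerBound) : Nolin2008_thm27_oneArm :=
  Nolin2008_thm27_oneArm_of_facts3 hQM Werner2009_halfPlane_twoArm_holds hP

end Literature.Probability.Percolation
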